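import Summits.CriticalPhenomena.PercolationContinuityZ3.Theorems.PercNearOneGluingNoHeavyLowerTailSunflowerMultiPetalRestriction
import HarnessLib
import HarnessLib.Audit

/-!
# `NoHeavyLowerTail` (crux stmt-CriticalPhenomena-4575), abstract sunflower cubic, `k` petals: the SLOT FORM `ZK = 6·#slots − #bads` of the
# multi-petal partition functional and the LOCAL MATCHING conjecture (LM) ⟹ `PartitionLemmaK`

Support file (seat `prim-l12-p2` gen 27; `--supports stmt-CriticalPhenomena-4575`; companion of `…SunflowerMultiPetal` (p338110: `MSunflower`, `s6K`, `ZK`,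
`PartitionLemmaK`), `…SunflowerMultiPetalRestriction` (p340634: `ZKW`, `ZKW_univ`), `…SunflowerRestrictionSingleton` (`nested`, `nested_swap12/23`),
`…SunflowerSpectatorTransferOrPetalPair` (`sum_parts_eq_nested_univ`) and, for the 2-block part of the conjecture, prim-ineq-gen-3's
`…OrientedAntipodalHallAcyclic` (`OrientedAntipodalHall.exists_injective_good_above_transitiveTournament`)).  No `sorry`; the `@[conjecture]` definition
is an obligation of the programme, never a fact.  Memo: run/shared/lean/prim/prim-l12/prim-l12-p2/FINDING-g27-EXHAUSTIVE-N6-AND-FORMS.md §2.2, §4.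

SLOT FORM (this work, `MSunflower.ZK_eq_slot`).  Call an ordered 3-partition `(K,S,T)` of the ground set a SLOT if `K` is decided (top or bottom), `S` is top and `T` is
bottom, and BAD if its three labels are pairwise distinct with at most one of them decided (= the partitions on which `s6K = −1`: two separated petal blocks
with a decided or third-petal block).  Then POINTWISE `s6K x y z = Σ_{σ ∈ S₃} slot(σ(x,y,z)) − bad(x,y,z)` (`s6K_eq_slotK`, a finite check on `Fin 5` transported to
every `k` by the chart `chart3`), hence, by the block symmetries of the sum over ordered 3-partitions,
    `ZK = 6 · #slotParts − #badParts`.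
So ★ₖ (`PartitionLemmaK`) says `#badParts ≤ 6 · #slotParts` ('six ordered readings of every bad partition fit into the slots').

(LM) LOCAL MATCHING WITH A FIXED SPECTATOR (`LocalMatchingK`) — **REFUTED on 6 points** (correction of the first version of this file, same seat/session): the
statement asks for an INJECTIVE map from the bad ordered partitions to `slotParts × Fin 6` which is local in the sense of `LMAdj` (an antipodal bad with a decided spectator `K`
must use a slot with THE SAME spectator `K` whose bottom block lies inside one of its two petal halves; a rainbow a slot whose spectator and bottom blocks are bottom pieces
of two different blocks).  It holds for ALL `(A,B)` pairs on ≤ 5 points (5 740 779 instances, 18 162 070 demands) but the EXHAUSTIVE 6-point census (kit j175068/j175070,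
4.8·10⁹ instances with ≥ 2 components, 3.2·10¹⁰ demands) found exactly ONE failing class up to S₆: ground set {0..5}, bottom family = ↓{01, 23, 45}, petal sets = the sets
meeting exactly two of the pairs {01},{23},{45} (three components), kernel = the transversals; it has 30 decided-spectator bads, 8 rainbows and 45 slots (so `ZK = 42 > 0`),
and under `LMAdj` all 38 demands together see only 37 slots (Hall deficiency 1).  A kernel refutation `¬ LocalMatchingK` is left to a successor (witness in the memo §4.6);
the statement is kept because `partitionLemmaK_of_localMatchingK` stays a valid (now vacuous-hypothesis) reduction.  The form that SURVIVES this instance and every test is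
the doubled-cube conjecture below, where the spectator of the slot is free.

* `partitionLemmaK_of_localMatchingK : LocalMatchingK → PartitionLemmaK` (cardinalities + the slot form).
* `DoubledCubeHallK` (conjecture (DC), the containment form in the doubled cube `2^(E ⊔ E)`: every bad partition has a slot ABOVE its encoding `(S, E ∖ T)`,
  injectively — the shape of the oriented antipodal Hall theorem one cube up) and `partitionLemmaK_of_doubledCubeHallK`.
-/

namespace Summit.CriticalPhenomena.PercolationContinuityZ3.Theorems.SunflowerPartition

open Finset

/-! ## Slot and bad indicators on label triples, and the pointwise slot form of `s6K` -/

/-- Slot indicator in reading order: first label decided (top or bottom), second top, third bottom. [this work] -/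
def slotK (k : ℕ) (x y z : Fin (k + 2)) : ℤ :=
  if (x = Fin.last (k + 1) ∨ x = 0) ∧ y = Fin.last (k + 1) ∧ z = 0 then 1 else 0

/-- Bad indicator: the three labels are pairwise distinct and at most one of them is decided (top or bottom). [this work] -/
def badK (k : ℕ) (x y z : Fin (k + 2)) : ℤ :=
  if (x ≠ y ∧ y ≠ z ∧ x ≠ z) ∧
      ¬ (((x = Fin.last (k + 1) ∨ x = 0) ∧ (y = Fin.last (k + 1) ∨ y = 0)) ∨
         ((x = Fin.last (k + 1) ∨ x = 0) ∧ (z = Fin.last (k + 1) ∨ z = 0)) ∨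
         ((y = Fin.last (k + 1) ∨ y = 0) ∧ (z = Fin.last (k + 1) ∨ z = 0)))
  then 1 else 0

/-- Transport of `slotK` along a top/bottom/equality-preserving relabelling. [this work] -/
theorem slotK_congr {k k' : ℕ} {x y z : Fin (k + 2)} {x' y' z' : Fin (k' + 2)}
    (hxt : x = Fin.last (k + 1) ↔ x' = Fin.last (k' + 1)) (hx0 : x = 0 ↔ x' = 0)
    (hyt : y = Fin.last (k + 1) ↔ y' = Fin.last (k' + 1)) (hz0 : z = 0 ↔ z' = 0) :
    slotK k x y z = slotK k' x' y' z' := by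
  unfold slotK
  exact if_congr (and_congr (or_congr hxt hx0) (and_congr hyt hz0)) rfl rfl

/-- Transport of `badK` along a top/bottom/equality-preserving relabelling. [this work] -/
theorem badK_congr {k k' : ℕ} {x y z : Fin (k + 2)} {x' y' z' : Fin (k' + 2)}
    (hxt : x = Fin.last (k + 1) ↔ x' = Fin.last (k' + 1)) (hx0 : x = 0 ↔ x' = 0)
    (hyt : y = Fin.last (k + 1) ↔ y' = Fin.last (k' + 1)) (hy0 : y = 0 ↔ y' = 0)
    (hzt : z = Fin.last (k + 1) ↔ z' = Fin.last (k' + 1)) (hz0 : z = 0 ↔ z' = 0)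
    (hxy : x = y ↔ x' = y') (hyz : y = z ↔ y' = z') (hxz : x = z ↔ x' = z') :
    badK k x y z = badK k' x' y' z' := by
  unfold badK
  exact if_congr (and_congr (and_congr (not_congr hxy) (and_congr (not_congr hyz) (not_congr hxz)))
    (not_congr (or_congr (and_congr (or_congr hxt hx0) (or_congr hyt hy0))
      (or_congr (and_congr (or_congr hxt hx0) (or_congr hzt hz0)) (and_congr (or_congr hyt hy0) (or_congr hzt hz0)))))) rfl rfl

/-- **Pointwise slot form of the kernel**: `s6K = Σ_{σ ∈ S₃} slotK ∘ σ − badK`, every `k` (finite check on `Fin 5`, transported by `chart3`). [this work] -/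
theorem s6K_eq_slotK (k : ℕ) (x y z : Fin (k + 2)) :
    s6K k x y z = slotK k x y z + slotK k x z y + slotK k y x z + slotK k y z x + slotK k z x y + slotK k z y x - badK k x y z := by
  have h5 : ∀ a b c : Fin 5, s6K 3 a b c =
      slotK 3 a b c + slotK 3 a c b + slotK 3 b a c + slotK 3 b c a + slotK 3 c a b + slotK 3 c b a - badK 3 a b c := by
    decide
  set c := chart3 k x y with hc
  have hxt := (chart3_eq_four_iff k x y x).symm; have hx0 := (chart3_eq_zero_iff k x y x).symm
  have hyt := (chart3_eq_four_iff k x y y).symm; have hy0 := (chart3_eq_zero_iff k x y y).symm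
  have hzt := (chart3_eq_four_iff k x y z).symm; have hz0 := (chart3_eq_zero_iff k x y z).symm
  have hxy : x = y ↔ c x = c y := chart3_eq_iff k x y (fun h _ => absurd rfl h.1)
  have hyz : y = z ↔ c y = c z := chart3_eq_iff k x y (fun h _ => absurd rfl h.2)
  have hxz : x = z ↔ c x = c z := chart3_eq_iff k x y (fun h _ => absurd rfl h.1)
  have hyx : y = x ↔ c y = c x := by rw [eq_comm, hxy, eq_comm]
  have hzy : z = y ↔ c z = c y := by rw [eq_comm, hyz, eq_comm]
  have hzx : z = x ↔ c z = c x := by rw [eq_comm, hxz, eq_comm]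
  have e4 : (4 : Fin 5) = Fin.last (3 + 1) := rfl
  rw [e4] at hxt hyt hzt
  rw [s6K_congr hxt hx0 hyt hy0 hzt hz0 hxy hyz hxz,
    slotK_congr hxt hx0 hyt hz0, slotK_congr hxt hx0 hzt hy0, slotK_congr hyt hy0 hxt hz0,
    slotK_congr hyt hy0 hzt hx0, slotK_congr hzt hz0 hxt hy0, slotK_congr hzt hz0 hyt hx0,
    badK_congr hxt hx0 hyt hy0 hzt hz0 hxy hyz hxz]
  exact h5 _ _ _

/-! ## Slots and bad ordered partitions of an `MSunflower`; the slot form of `ZK` -/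

namespace MSunflower

variable {α : Type*} [DecidableEq α] [Fintype α] {k : ℕ} (F : MSunflower k α)

/-- The SLOTS: ordered 3-partitions `(K, S, T)` (coded `(K, S)`, `T = (K ∪ S)ᶜ`) with `K` decided, `S` top and `T` bottom. [this work] -/
def slotParts : Finset (Finset α × Finset α) :=
  (parts α).filter fun q =>
    (F.lab q.1 = Fin.last (k + 1) ∨ F.lab q.1 = 0) ∧ F.lab q.2 = Fin.last (k + 1) ∧ F.lab (q.1 ∪ q.2)ᶜ = 0

/-- The BAD ordered 3-partitions: pairwise distinct labels, at most one decided (six orderings of every decided-spectator antipodal bad and of every rainbow). [this work] -/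
def badParts : Finset (Finset α × Finset α) :=
  (parts α).filter fun q =>
    (F.lab q.1 ≠ F.lab q.2 ∧ F.lab q.2 ≠ F.lab (q.1 ∪ q.2)ᶜ ∧ F.lab q.1 ≠ F.lab (q.1 ∪ q.2)ᶜ) ∧
      ¬ (((F.lab q.1 = Fin.last (k + 1) ∨ F.lab q.1 = 0) ∧ (F.lab q.2 = Fin.last (k + 1) ∨ F.lab q.2 = 0)) ∨
         ((F.lab q.1 = Fin.last (k + 1) ∨ F.lab q.1 = 0) ∧ (F.lab (q.1 ∪ q.2)ᶜ = Fin.last (k + 1) ∨ F.lab (q.1 ∪ q.2)ᶜ = 0)) ∨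
         ((F.lab q.2 = Fin.last (k + 1) ∨ F.lab q.2 = 0) ∧ (F.lab (q.1 ∪ q.2)ᶜ = Fin.last (k + 1) ∨ F.lab (q.1 ∪ q.2)ᶜ = 0)))

/-- The slot count as a sum of the slot indicator over ordered 3-partitions. [this work] -/
theorem card_slotParts_eq_sum :
    ((F.slotParts).card : ℤ) = ∑ q ∈ parts α, slotK k (F.lab q.1) (F.lab q.2) (F.lab (q.1 ∪ q.2)ᶜ) := by
  unfold slotParts slotK
  rw [Finset.sum_boole]

/-- The bad count as a sum of the bad indicator over ordered 3-partitions. [this work] -/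
theorem card_badParts_eq_sum :
    ((F.badParts).card : ℤ) = ∑ q ∈ parts α, badK k (F.lab q.1) (F.lab q.2) (F.lab (q.1 ∪ q.2)ᶜ) := by
  unfold badParts badK
  rw [Finset.sum_boole]

omit [Fintype α] in
/-- Cyclic block symmetry of the nested sum (from the two transpositions). [this work] -/
theorem nested_cycle (W : Finset α) (G : Finset α → Finset α → Finset α → ℤ) :
    nested W G = nested W (fun X S T => G S T X) := by
  rw [nested_swap23 W G, nested_swap12 W (fun X S T => G X T S)]

omit [Fintype α] in
/-- The inverse cyclic block symmetry of the nested sum. [this work] -/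
theorem nested_cycle' (W : Finset α) (G : Finset α → Finset α → Finset α → ℤ) :
    nested W G = nested W (fun X S T => G T X S) := by
  rw [nested_swap12 W G, nested_swap23 W (fun X S T => G S X T)]

/-- Every reading of the slot indicator has the same sum over ordered 3-partitions (block symmetry). [this work] -/
theorem sum_slotK_perm :
    (∑ q ∈ parts α, slotK k (F.lab q.1) (F.lab (q.1 ∪ q.2)ᶜ) (F.lab q.2)) = ∑ q ∈ parts α, slotK k (F.lab q.1) (F.lab q.2) (F.lab (q.1 ∪ q.2)ᶜ) ∧
    (∑ q ∈ parts α, slotK k (F.lab q.2) (F.lab q.1) (F.lab (q.1 ∪ q.2)ᶜ)) = ∑ q ∈ parts α, slotK k (F.lab q.1) (F.lab q.2) (F.lab (q.1 ∪ q.2)ᶜ) ∧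
    (∑ q ∈ parts α, slotK k (F.lab q.2) (F.lab (q.1 ∪ q.2)ᶜ) (F.lab q.1)) = ∑ q ∈ parts α, slotK k (F.lab q.1) (F.lab q.2) (F.lab (q.1 ∪ q.2)ᶜ) ∧
    (∑ q ∈ parts α, slotK k (F.lab (q.1 ∪ q.2)ᶜ) (F.lab q.1) (F.lab q.2)) = ∑ q ∈ parts α, slotK k (F.lab q.1) (F.lab q.2) (F.lab (q.1 ∪ q.2)ᶜ) ∧
    (∑ q ∈ parts α, slotK k (F.lab (q.1 ∪ q.2)ᶜ) (F.lab q.2) (F.lab q.1)) = ∑ q ∈ parts α, slotK k (F.lab q.1) (F.lab q.2) (F.lab (q.1 ∪ q.2)ᶜ) := by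
  have base := sum_parts_eq_nested_univ (α := α) (fun X Y Z => slotK k (F.lab X) (F.lab Y) (F.lab Z))
  refine ⟨?_, ?_, ?_, ?_, ?_⟩
  · rw [sum_parts_eq_nested_univ (g := fun X Y Z => slotK k (F.lab X) (F.lab Z) (F.lab Y)), base, ← nested_swap23]
  · rw [sum_parts_eq_nested_univ (g := fun X Y Z => slotK k (F.lab Y) (F.lab X) (F.lab Z)), base, ← nested_swap12]
  · rw [sum_parts_eq_nested_univ (g := fun X Y Z => slotK k (F.lab Y) (F.lab Z) (F.lab X)), base,
      nested_cycle univ (fun X Y Z => slotK k (F.lab X) (F.lab Y) (F.lab Z))]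
  · rw [sum_parts_eq_nested_univ (g := fun X Y Z => slotK k (F.lab Z) (F.lab X) (F.lab Y)), base,
      nested_cycle' univ (fun X Y Z => slotK k (F.lab X) (F.lab Y) (F.lab Z))]
  · rw [sum_parts_eq_nested_univ (g := fun X Y Z => slotK k (F.lab Z) (F.lab Y) (F.lab X)), base,
      nested_swap12 univ (fun X Y Z => slotK k (F.lab X) (F.lab Y) (F.lab Z)),
      nested_swap23 univ (fun X S T => slotK k (F.lab S) (F.lab X) (F.lab T)),
      nested_swap12 univ (fun X S T => slotK k (F.lab T) (F.lab X) (F.lab S))]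

/-- **SLOT FORM of the multi-petal partition functional**: `ZK = 6 · #slots − #bads`. [this work] -/
theorem ZK_eq_slot : F.ZK = 6 * ((F.slotParts).card : ℤ) - (F.badParts).card := by
  obtain ⟨h1, h2, h3, h4, h5⟩ := F.sum_slotK_perm
  rw [card_slotParts_eq_sum, card_badParts_eq_sum]
  unfold ZK
  simp_rw [s6K_eq_slotK]
  rw [sum_sub_distrib, sum_add_distrib, sum_add_distrib, sum_add_distrib, sum_add_distrib, sum_add_distrib, h1, h2, h3, h4, h5]
  ring

/-- ★ₖ restated: `0 ≤ ZK ↔ #badParts ≤ 6 · #slotParts`. [this work] -/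
theorem ZK_nonneg_iff_card : 0 ≤ F.ZK ↔ (F.badParts).card ≤ 6 * (F.slotParts).card := by
  rw [F.ZK_eq_slot]
  constructor
  · intro h; exact_mod_cast (by linarith : ((F.badParts).card : ℤ) ≤ 6 * (F.slotParts).card)
  · intro h; have : ((F.badParts).card : ℤ) ≤ 6 * ((F.slotParts).card : ℤ) := by exact_mod_cast h
    linarith

/-! ## The local matching conjecture and the reduction -/

/-- LOCAL adjacency of a bad ordered partition `q = (X, Y, Z)` and a slot `s = (K, S, T)` (`Z = (X ∪ Y)ᶜ`, `T = (K ∪ S)ᶜ`):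
either some block of `q` is decided, equals the spectator `K` of the slot, and the bottom block `T` of the slot lies inside one of the two other
(petal) blocks of `q`; or all three blocks of `q` are petal blocks (a rainbow) and `K`, `T` are contained in two DIFFERENT blocks of `q`. [this work] -/
def LMAdj (q s : Finset α × Finset α) : Prop :=
  let X := q.1; let Y := q.2; let Z := (q.1 ∪ q.2)ᶜ; let K := s.1; let T := (s.1 ∪ s.2)ᶜ
  ((F.lab X = Fin.last (k + 1) ∨ F.lab X = 0) ∧ K = X ∧ (T ⊆ Y ∨ T ⊆ Z)) ∨
  ((F.lab Y = Fin.last (k + 1) ∨ F.lab Y = 0) ∧ K = Y ∧ (T ⊆ X ∨ T ⊆ Z)) ∨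
  ((F.lab Z = Fin.last (k + 1) ∨ F.lab Z = 0) ∧ K = Z ∧ (T ⊆ X ∨ T ⊆ Y)) ∨
  ((¬ (F.lab X = Fin.last (k + 1) ∨ F.lab X = 0)) ∧ (¬ (F.lab Y = Fin.last (k + 1) ∨ F.lab Y = 0)) ∧
    (¬ (F.lab Z = Fin.last (k + 1) ∨ F.lab Z = 0)) ∧
    ((K ⊆ X ∧ (T ⊆ Y ∨ T ⊆ Z)) ∨ (K ⊆ Y ∧ (T ⊆ X ∨ T ⊆ Z)) ∨ (K ⊆ Z ∧ (T ⊆ X ∨ T ⊆ Y))))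

/-- DOUBLED-CUBE adjacency (orientation by the label order): the slot `s = (K, S, T)` lies ABOVE the bad partition `q` in the doubled cube
`2^(E ⊔ E)` under the encoding `(S, E ∖ T)`, i.e. `S ⊇ P` and `T ⊆ P'`, where `P, P'` are the two petal blocks of `q` of smallest labels, `lab P < lab P'`
(for an antipodal bad with a decided spectator: its two petal halves; for a rainbow: the blocks of least and middle label).  The spectator of the slot is free. [this work] -/
def DCAdj (q s : Finset α × Finset α) : Prop :=
  ∃ P P' : Finset α, (P = q.1 ∨ P = q.2 ∨ P = (q.1 ∪ q.2)ᶜ) ∧ (P' = q.1 ∨ P' = q.2 ∨ P' = (q.1 ∪ q.2)ᶜ) ∧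
    ¬ (F.lab P = Fin.last (k + 1) ∨ F.lab P = 0) ∧ ¬ (F.lab P' = Fin.last (k + 1) ∨ F.lab P' = 0) ∧ F.lab P < F.lab P' ∧
    (∀ P'' : Finset α, (P'' = q.1 ∨ P'' = q.2 ∨ P'' = (q.1 ∪ q.2)ᶜ) → ¬ (F.lab P'' = Fin.last (k + 1) ∨ F.lab P'' = 0) →
      P'' ≠ P → P'' ≠ P' → F.lab P' < F.lab P'') ∧
    P ⊆ s.2 ∧ (s.1 ∪ s.2)ᶜ ⊆ P'

end MSunflower

/-- **(LM) local matching with a FIXED spectator — REFUTED** (this work; FALSE on 6 points, see the header: bottom family ↓{01,23,45}, petals = sets meeting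
exactly two of the three pairs, kernel = transversals; Hall deficiency 1; exhaustive census kit j175070).  Kept as a plain named statement (no longer an obligation)
because `partitionLemmaK_of_localMatchingK` is a valid reduction; the live conjecture is `DoubledCubeHallK`. [status: refuted by census; kernel refutation pending] -/
def LocalMatchingK : Prop :=
  ∀ (k : ℕ) (α : Type) [Fintype α] [DecidableEq α] (F : MSunflower k α),
    ∃ ψ : ↥F.badParts → ↥F.slotParts × Fin 6, Function.Injective ψ ∧ ∀ q, F.LMAdj q.1 (ψ q).1.1

/-- **(DC) DOUBLED-CUBE HALL CONJECTURE** (this work; OPEN; census-clean: all `(A,B)` on ≤ 5 points for EACH of the six rainbow encodings, ≈ 2·10⁵ random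
instances on 6–8 points — memo §4.5): encoding an ordered 3-partition `(spectator; S; T)` by the pair `(S, E ∖ T)`, a point of the doubled cube `2^(E ⊔ E)`, every bad
partition (antipodal bad with a decided spectator, oriented by the label order of its two petal halves; rainbow, read as (·; least label; middle label)) has a slot
ABOVE it in the doubled cube (`MSunflower.DCAdj`), injectively (multiplicity six for the six orderings).  This is the shape of prim-ineq-gen-3's oriented antipodal
Hall theorem ('bads have distinct goods above them', acyclic types) one cube up, with the rainbows as additional bads.  Implies `PartitionLemmaK`
(`partitionLemmaK_of_doubledCubeHallK`).  An obligation, never a fact: use as `(h : DoubledCubeHallK)`. [status: open] -/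
@[conjecture] def DoubledCubeHallK : Prop :=
  ∀ (k : ℕ) (α : Type) [Fintype α] [DecidableEq α] (F : MSunflower k α),
    ∃ ψ : ↥F.badParts → ↥F.slotParts × Fin 6, Function.Injective ψ ∧ ∀ q, F.DCAdj q.1 (ψ q).1.1

/-- **(DC) ⟹ ★ₖ** (cardinalities + the slot form). [this work] -/
theorem partitionLemmaK_of_doubledCubeHallK (h : DoubledCubeHallK) : PartitionLemmaK := by
  intro k α _ _ F
  obtain ⟨ψ, hψ, -⟩ := h k α F
  rw [F.ZK_nonneg_iff_card]
  have hc := Fintype.card_le_of_injective ψ hψ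
  rw [Fintype.card_prod, Fintype.card_fin, Fintype.card_coe, Fintype.card_coe] at hc
  linarith

/-- **(LM) ⟹ ★ₖ**: an injective assignment of slots-with-multiplicity-six to the bad partitions gives `#badParts ≤ 6 · #slotParts`, i.e. `0 ≤ ZK`
by the slot form. [this work] -/
theorem partitionLemmaK_of_localMatchingK (h : LocalMatchingK) : PartitionLemmaK := by
  intro k α _ _ F
  obtain ⟨ψ, hψ, -⟩ := h k α F
  rw [F.ZK_nonneg_iff_card]
  have hc := Fintype.card_le_of_injective ψ hψ
  rw [Fintype.card_prod, Fintype.card_fin, Fintype.card_coe, Fintype.card_coe] at hc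
  linarith

end Summit.CriticalPhenomena.PercolationContinuityZ3.Theorems.SunflowerPartition
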